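import Summits.KontsevichZagierPeriods.KontsevichZagierPeriods.Theses.HurwitzMicroSectors

/-!
# Route HurwitzMicroSectors — `Assembly` (item stmt-KontsevichZagierPeriods-3878)

The assembly step of route `KontsevichZagierPeriods/HurwitzMicroSectors`:

  `NormalFormPrinciple → KontsevichZagierPeriods`.

`NormalFormPrinciple` posits a family `𝒩 = (𝒩 n ⊆ KZ.IntegralRep n)` of normal-form integral
representations with
* (rigidity) `N ∈ 𝒩 n`, `N' ∈ 𝒩 m`, `N.value = N'.value ⟹ KZ.Equivalent N N'`, and
* (reduction) every rational representation `r` is KZ-equivalent to some `N ∈ 𝒩 m`.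

The summit `KontsevichZagierPeriods` (`= Literature.Periods.KZPeriodConjecture`, Kontsevich–Zagier's
Conjecture 1 over the calculus `Literature.NumberTheory.Transcendental.KZCalculus`) asks that two
rational representations `r`, `r'` with `r.value = r'.value` be KZ-equivalent.  Proof: reduce both to
normal forms `N ~ r`, `N' ~ r'`; soundness of the moves
(`Literature.NumberTheory.Transcendental.KZ.Equivalent.value_eq_holds`) transports the value
equality to `N.value = N'.value`; rigidity gives `N ~ N'`; compose in the subgroup of relations
(`KZ.Equivalent.trans`, `KZ.Equivalent.symm`).  Pure logic over the route's definitions; the same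
argument is the route's deciding theorem `…Theses.HurwitzMicroSectors.closes`, but this file proves
the item from the definitions directly (it does not cite `closes`).

References: M. Kontsevich, D. Zagier, *Periods* (2001), §1.2, Conjecture 1;
A. Huber, S. Müller-Stach, *Periods and Nori Motives* (2017), §13.1.
-/

namespace Summit.KontsevichZagierPeriods.Theorems.HurwitzMicroSectorsAssembly

open Literature.NumberTheory.Transcendental

/-- **Assembly of route HurwitzMicroSectors** (settles stmt-KontsevichZagierPeriods-3878):
`NormalFormPrinciple → KontsevichZagierPeriods`.  Given a normal-form family `𝒩` (rigidity: members
with equal values are KZ-equivalent; reduction: every rational representation is KZ-equivalent to a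
member), two rational integral representations `r`, `r'` with `r.value = r'.value` are KZ-equivalent:
`r ~ N`, `r' ~ N'` by reduction, `N.value = N'.value` by soundness of the moves
(`KZ.Equivalent.value_eq_holds`), `N ~ N'` by rigidity, and `r ~ N ~ N' ~ r'` by transitivity and
symmetry of `KZ.Equivalent`. [Kontsevich–Zagier 2001, §1.2, Conjecture 1] [folklore] -/
theorem assembly_proof :
    Summit.KontsevichZagierPeriods.KontsevichZagierPeriods.Theses.HurwitzMicroSectors.Assembly := by
  unfold Summit.KontsevichZagierPeriods.KontsevichZagierPeriods.Theses.HurwitzMicroSectors.Assembly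
    Summit.KontsevichZagierPeriods.KontsevichZagierPeriods.Theses.HurwitzMicroSectors.NormalFormPrinciple
  rintro ⟨𝒩, hrig, hred⟩
  rw [KontsevichZagierPeriods_iff]
  intro n m r r' hr hr' hv
  obtain ⟨k, N, hN, hrN⟩ := hred n r hr
  obtain ⟨k', N', hN', hrN'⟩ := hred m r' hr'
  have h1 : r.value = N.value := KZ.Equivalent.value_eq_holds hrN
  have h2 : r'.value = N'.value := KZ.Equivalent.value_eq_holds hrN'
  have hvN : N.value = N'.value := by rw [← h1, ← h2, hv]
  exact (hrN.trans (hrig k k' N N' hN hN' hvN)).trans hrN'.symm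

end Summit.KontsevichZagierPeriods.Theorems.HurwitzMicroSectorsAssembly
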